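import Literature.AnabelianGeometry.SemiGraphs.TemperedAnabelianThm68Sub

/-!
# [SemiAnbd] Thm. 6.8 (iii) sub-DAG: the "multiplication by `n`" subgroup is unique up to conjugation
# (uniqueness half of row T68iii-L02), from the two facts that make a curve "once-punctured"

Mochizuki, *Semi-graphs of anabelioids* [SemiAnbd], §6 Thm. 6.8 (iii), kurims p. 75, whose proof is
[Mzk8] (*Galois sections in absolute anabelian geometry*) Cor. 2.6, proof p. 10: the covering
`Z_K → X_K` "determined by multiplication by `n`" is "the covering associated to the open subgroup
`H ⊆ Π_{X_K}` [which is easily verified to be unique, up to conjugation in `Π_{X_K}`] such that: (i)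
`H` contains a cuspidal decomposition group of `Π_{X_K}`; (ii) `H ∩ Δ_X` is equal to the inverse
image in `Δ_X` of the subgroup `n · Δ_X^ab ⊆ Δ_X^ab`."
[cite: MochizukiSemiAnbd2006, Thm 6.8(iii) p.75] [cite: MochizukiGalSect2005, Cor 2.6 p.10]

PROOF-ONLY companion (abc-iut cell, layer L3, prover abc-iut-w5-d139; row «uniqueness half of
T68iii-L02» of `plan/L3/SUBDAG-SemiAnbd-Thm68.md`, holder abc-iut-w5-d040) of the statements file
`TemperedAnabelianThm68Sub.lean` (`Thm68Sub.IsMulNSubgroup`, `Thm68Sub.MulNSubgroupExistsUnique`).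
The "easily verified" uniqueness is PROVED over the interface `TemperedCurve p` from EXACTLY the two
interface-level facts that are the content of "once-punctured" for this argument (the flag
`IsOncePuncturedElliptic` of `CurveArithmeticFlags` carries no data, so they are named hypotheses):
(C1) `X̄_K ∖ X_K` is ONE point — any two cusps are equal; (C2) that cusp is `K`-rational — its
decomposition group surjects onto `G_K` (same image under the augmentation as `Π^temp_{X_K}`).
Argument (`mulNSubgroup_conj_of`): for `H` as in (i)(ii) with cuspidal `D ≤ H`, `aug(D) = G_K` gives
`H = H_Δ(n) · D` where `H_Δ(n) := {δ ∈ Δ^temp_X : δ̄ ∈ n·(Δ^temp_X)^ab}` is normal in `Π^temp_{X_K}`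
(conjugation acts on `Δ^temp_X` and on its abelianization, preserving `n`-th powers); two cuspidal
decomposition groups are conjugate by (C1); hence `H' = γ H γ⁻¹`.  Without (C2) the typed statement is
false over the interface (lifts over `G_K ∖ aug(D)` are unconstrained), so (C1)(C2) are the honest
residual; Thm. 6.5 is not needed.  Existence of `H` (the finite étale `[n] : E ∖ E[n] → E ∖ O`) is
scheme-side input and enters the wrapper `mulNSubgroupExistsUnique_of` BY NAME.  Mathlib only; no new
definition; nothing asserted; nothing here takes a side on [IUTchIII] Cor. 3.12.
-/

noncomputable section

namespace Literature.AnabelianGeometry.SemiGraphs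

open scoped Pointwise

namespace Thm68Sub

variable {p : ℕ} [Fact p.Prime]

/-- Normality of `Δ^temp_X = ker(aug)` (bookkeeping). [cite: MochizukiSemiAnbd2006, §6 p.69] -/
private theorem deltaTemp_normal (X : TemperedCurve p) : X.DeltaTemp.Normal := by
  unfold TemperedCurve.DeltaTemp
  infer_instance

/-- Condition (ii) of `IsMulNSubgroup` is stable under conjugation by any element of `Π^temp_{X_K}`:
if `δ̄ ∈ n · (Δ^temp_X)^ab` then the same holds for `c δ c⁻¹` (conjugation induces an automorphism of
`Δ^temp_X`, hence of its abelianization, commuting with `n`-th powers).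
[cite: MochizukiGalSect2005, Cor 2.6 p.10] -/
theorem mem_range_pow_of_conj (X : TemperedCurve p) (n : ℕ) (c : X.PiTemp) (δ : X.DeltaTemp)
    (h : Abelianization.of δ ∈ (powMonoidHom n : Abelianization X.DeltaTemp →* _).range) :
    haveI := deltaTemp_normal X
    Abelianization.of (MulAut.conjNormal c δ) ∈
      (powMonoidHom n : Abelianization X.DeltaTemp →* _).range := by
  haveI := deltaTemp_normal X
  obtain ⟨a, ha⟩ := h
  refine ⟨Abelianization.map ((MulAut.conjNormal c : MulAut X.DeltaTemp) : X.DeltaTemp →* X.DeltaTemp) a, ?_⟩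
  rw [powMonoidHom_apply] at ha ⊢
  rw [← map_pow, ha, Abelianization.map_of]
  rfl

/-- A cuspidal decomposition group over a `K`-RATIONAL cusp (hypothesis (C2): `D_x` surjects onto
`G_K`) has the same image under the augmentation as the whole of `Π^temp_{X_K}`; the same then holds
for all its conjugates. [cite: MochizukiSemiAnbd2006, §6 p.71] -/
theorem exists_mem_cuspidal_aug_eq (X : TemperedCurve p)
    (hrat : ∀ x : X.Pt, X.IsCusp x → ∀ g : X.PiTemp, ∃ d ∈ X.decomp x, X.aug d = X.aug g)
    {x : X.Pt} (hx : X.IsCusp x) (γ : ConjAct X.PiTemp) (g : X.PiTemp) :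
    ∃ d ∈ γ • X.decomp x, X.aug d = X.aug g := by
  obtain ⟨d₀, hd₀, hd₀g⟩ :=
    hrat x hx ((ConjAct.ofConjAct γ)⁻¹ * g * ConjAct.ofConjAct γ)
  refine ⟨γ • d₀, Subgroup.smul_mem_pointwise_smul_iff.mpr hd₀, ?_⟩
  rw [ConjAct.smul_def, map_mul, map_mul, map_inv, hd₀g, map_mul, map_mul, map_inv]
  group

/-- **One inclusion of the conjugacy** ([Mzk8] Cor. 2.6 proof p. 10, "easily verified to be unique,
up to conjugation"): if `H` satisfies (i)(ii) with the cuspidal group `γ·D_x ≤ H` and `H'` satisfies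
(ii) with `γ'·D_x ≤ H'` (same — by (C1) the only — cusp `x`, assumed `K`-rational (C2)), then
`(γ'γ⁻¹) H (γ'γ⁻¹)⁻¹ ≤ H'`.  Mechanism: `H = H_Δ(n)·(γ·D_x)`, `H_Δ(n)` normal.
[cite: MochizukiGalSect2005, Cor 2.6 p.10] -/
theorem conj_mem_of_isMulNSubgroup (X : TemperedCurve p)
    (hrat : ∀ x : X.Pt, X.IsCusp x → ∀ g : X.PiTemp, ∃ d ∈ X.decomp x, X.aug d = X.aug g)
    (n : ℕ) {H H' : Subgroup X.PiTemp} {x : X.Pt} (hx : X.IsCusp x) (γ γ' : ConjAct X.PiTemp)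
    (hD : γ • X.decomp x ≤ H) (hD' : γ' • X.decomp x ≤ H')
    (hH : ∀ δ : X.DeltaTemp, ((δ : X.PiTemp) ∈ H ↔
      Abelianization.of δ ∈ (powMonoidHom n : Abelianization X.DeltaTemp →* _).range))
    (hH' : ∀ δ : X.DeltaTemp, ((δ : X.PiTemp) ∈ H' ↔
      Abelianization.of δ ∈ (powMonoidHom n : Abelianization X.DeltaTemp →* _).range))
    (h : X.PiTemp) (hh : h ∈ H) :
    (ConjAct.ofConjAct γ' * (ConjAct.ofConjAct γ)⁻¹) * h *
      (ConjAct.ofConjAct γ' * (ConjAct.ofConjAct γ)⁻¹)⁻¹ ∈ H' := by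
  haveI := deltaTemp_normal X
  set c : X.PiTemp := ConjAct.ofConjAct γ' * (ConjAct.ofConjAct γ)⁻¹ with hc
  -- split `h = δ * d` with `d ∈ γ·D_x ≤ H` and `δ ∈ H ∩ Δ^temp`
  obtain ⟨d, hdD, hdaug⟩ := exists_mem_cuspidal_aug_eq X hrat hx γ h
  have hdH : d ∈ H := hD hdD
  have hδΔ : h * d⁻¹ ∈ X.DeltaTemp := by
    show h * d⁻¹ ∈ X.aug.toMonoidHom.ker
    rw [MonoidHom.mem_ker, map_mul, map_inv]
    change X.aug h * (X.aug d)⁻¹ = 1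
    rw [hdaug, mul_inv_cancel]
  have hδH : h * d⁻¹ ∈ H := H.mul_mem hh (H.inv_mem hdH)
  -- `δ̄ ∈ n·Δ^ab`, hence the same for `c δ c⁻¹`, hence `c δ c⁻¹ ∈ H'`
  have hδR := (hH ⟨h * d⁻¹, hδΔ⟩).mp hδH
  have hcδR := mem_range_pow_of_conj X n c ⟨h * d⁻¹, hδΔ⟩ hδR
  have hcδH' : c * (h * d⁻¹) * c⁻¹ ∈ H' := by
    have := (hH' (MulAut.conjNormal c ⟨h * d⁻¹, hδΔ⟩)).mpr hcδR
    simpa [MulAut.conjNormal_apply] using this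
  -- `c d c⁻¹ ∈ γ'·D_x ≤ H'`
  obtain ⟨d₀, hd₀, rfl⟩ := (Subgroup.mem_smul_pointwise_iff_exists d γ (X.decomp x)).mp hdD
  have hcdH' : c * (γ • d₀) * c⁻¹ ∈ H' := by
    apply hD'
    refine (Subgroup.mem_smul_pointwise_iff_exists _ γ' (X.decomp x)).mpr ⟨d₀, hd₀, ?_⟩
    rw [ConjAct.smul_def, ConjAct.smul_def, hc]
    group
  -- assemble: `c h c⁻¹ = (c δ c⁻¹) (c d c⁻¹)`
  have : c * h * c⁻¹ = (c * (h * (γ • d₀)⁻¹) * c⁻¹) * (c * (γ • d₀) * c⁻¹) := by group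
  rw [this]
  exact H'.mul_mem hcδH' hcdH'

/-- **Uniqueness up to conjugation of the `[n]`-subgroup** ([Mzk8] Cor. 2.6 proof p. 10: "`H ⊆ Π_{X_K}`
[which is easily verified to be unique, up to conjugation in `Π_{X_K}`]"), PROVED over the interface
from (C1) "one cusp" and (C2) "its decomposition group surjects onto `G_K`" (the cusp is
`K`-rational): any two subgroups satisfying `IsMulNSubgroup X n` are `Π^temp_{X_K}`-conjugate.
[cite: MochizukiGalSect2005, Cor 2.6 p.10] -/
theorem mulNSubgroup_conj_of (X : TemperedCurve p)
    (hone : ∀ x x' : X.Pt, X.IsCusp x → X.IsCusp x' → x = x')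
    (hrat : ∀ x : X.Pt, X.IsCusp x → ∀ g : X.PiTemp, ∃ d ∈ X.decomp x, X.aug d = X.aug g)
    (n : ℕ) (H H' : Subgroup X.PiTemp) (hH : IsMulNSubgroup X n H) (hH' : IsMulNSubgroup X n H') :
    ∃ γ : ConjAct X.PiTemp, H' = γ • H := by
  obtain ⟨-, -, ⟨D, ⟨x, hx, γ, rfl⟩, hDH⟩, hiff⟩ := hH
  obtain ⟨-, -, ⟨D', ⟨x', hx', γ', rfl⟩, hD'H'⟩, hiff'⟩ := hH'
  obtain rfl : x = x' := hone x x' hx hx'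
  set c : X.PiTemp := ConjAct.ofConjAct γ' * (ConjAct.ofConjAct γ)⁻¹ with hc
  refine ⟨ConjAct.toConjAct c, ?_⟩
  ext y
  rw [Subgroup.mem_smul_pointwise_iff_exists]
  constructor
  · intro hy
    -- `c⁻¹ y c ∈ H` by the symmetric inclusion, and `c • (c⁻¹ y c) = y`
    refine ⟨c⁻¹ * y * c, ?_, by rw [ConjAct.toConjAct_smul]; group⟩
    have h := conj_mem_of_isMulNSubgroup X hrat n hx γ' γ hD'H' hDH hiff' hiff y hy
    have hcinv : ConjAct.ofConjAct γ * (ConjAct.ofConjAct γ')⁻¹ = c⁻¹ := by rw [hc]; group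
    rw [hcinv, inv_inv] at h
    exact h
  · rintro ⟨h, hh, rfl⟩
    rw [ConjAct.toConjAct_smul]
    exact conj_mem_of_isMulNSubgroup X hrat n hx γ γ' hDH hD'H' hiff hiff' h hh

/-- **Row T68iii-L02 from its honest inputs**: `MulNSubgroupExistsUnique X a` follows from (C1) one
cusp, (C2) its decomposition group surjects onto `G_K`, and the EXISTENCE of an `[n]`-subgroup for
every `n ≥ 1` (scheme side: the finite étale covering `[n] : E ∖ E[n] → E ∖ O`, [Mzk8] p. 10 — input BY
NAME; not asserted). [cite: MochizukiGalSect2005, Cor 2.6 p.10] -/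
theorem mulNSubgroupExistsUnique_of (X : TemperedCurve p) (a : TemperedCurve.CurveArithmeticFlags X)
    (hone : ∀ x x' : X.Pt, X.IsCusp x → X.IsCusp x' → x = x')
    (hrat : ∀ x : X.Pt, X.IsCusp x → ∀ g : X.PiTemp, ∃ d ∈ X.decomp x, X.aug d = X.aug g)
    (hex : a.IsOncePuncturedElliptic → ∀ n : ℕ, 1 ≤ n → ∃ H, IsMulNSubgroup X n H) :
    MulNSubgroupExistsUnique X a :=
  fun hell n hn => ⟨hex hell n hn, fun H H' hH hH' => mulNSubgroup_conj_of X hone hrat n H H' hH hH'⟩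

end Thm68Sub

end Literature.AnabelianGeometry.SemiGraphs

end
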